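import Literature.NumberTheory.GaloisRepresentations.GrossencharakterIdeleValue
import Mathlib.NumberTheory.NumberField.InfinitePlace.TotallyRealComplex
import Mathlib.NumberTheory.NumberField.Norm
import HarnessLib

/-!
# Products of algebraic Größencharaktere and the norm character

Topic `NumberTheory/GaloisRepresentations`; namespace `Literature.NumberTheory.GaloisRepresentations`.
Theorems only.

* `IsGrossencharakter.mul` — the product of two algebraic Größencharaktere modulo `𝔣` of types
  `(p₁, q₁)`, `(p₂, q₂)` is one of type `(p₁ + p₂, q₁ + q₂)`;
* `idealPow_absNorm` — `idealPow (v ↦ N v) 𝔞 = N 𝔞`;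
* `isGrossencharakter_absNorm` — over a totally complex field the absolute norm `v ↦ N v` is an
  algebraic Größencharakter of type `(1, 1)` (modulo any `𝔣`): `N((b)) = N((c)) · ∏_w w(b/c) \overline{w(b/c)}`;
* `isGrossencharakter_absNorm'` — over ANY number field `v ↦ N v` is an algebraic Größencharakter of
  type `(1, mult − 1)` (`N((x)) = ∏_w |x|_w^{mult w}`, `absNorm_span_singleton_eq_prod_pow`, and at a
  real place `w(b/c) = |b/c|_w` for `b/c` totally positive, `embedding_mul_conj_pow_eq`).

[cite: NeukirchANT1999, Ch. VII §6, after Def. (6.1) (examples); Ch. III §1 (the absolute norm)]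

## References

* J. Neukirch, *Algebraic Number Theory* (1999), Ch. VII §6; Ch. III §1. [NeukirchANT1999]
-/

noncomputable section

open scoped NumberField ComplexConjugate
open IsDedekindDomain NumberField

namespace Literature.NumberTheory.GaloisRepresentations

variable {K : Type} [Field K] [NumberField K]

/-! ### Products -/

/-- `(ψ₁ψ₂)(𝔞) = ψ₁(𝔞) ψ₂(𝔞)`. [folklore] -/
theorem idealPow_mul_fun' (ψ₁ ψ₂ : HeightOneSpectrum (𝓞 K) → ℂ) {I : Ideal (𝓞 K)} (hI : I ≠ ⊥) :
    LFunctions.idealPow K (fun v => ψ₁ v * ψ₂ v) I = LFunctions.idealPow K ψ₁ I * LFunctions.idealPow K ψ₂ I := by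
  unfold LFunctions.idealPow
  rw [← finprod_mul_distrib (LFunctions.mulSupport_idealPow_finite ψ₁ hI) (LFunctions.mulSupport_idealPow_finite ψ₂ hI)]
  exact finprod_congr fun v => mul_pow _ _ _

/-- **The product of two algebraic Größencharaktere is an algebraic Größencharakter.**
[cite: NeukirchANT1999, Ch. VII §6] -/
theorem IsGrossencharakter.mul {𝔣 : Ideal (𝓞 K)} {p₁ q₁ p₂ q₂ : InfinitePlace K → ℤ}
    {ψ₁ ψ₂ : HeightOneSpectrum (𝓞 K) → ℂ} (h₁ : IsGrossencharakter 𝔣 p₁ q₁ ψ₁) (h₂ : IsGrossencharakter 𝔣 p₂ q₂ ψ₂) :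
    IsGrossencharakter 𝔣 (fun w => p₁ w + p₂ w) (fun w => q₁ w + q₂ w) (fun v => ψ₁ v * ψ₂ v) := by
  refine ⟨fun v hv => mul_ne_zero (h₁.ne_zero v hv) (h₂.ne_zero v hv), fun b c hb hc hcop hbc hpos => ?_⟩
  have hb' : Ideal.span {b} ≠ ⊥ := by rwa [Ne, Ideal.span_singleton_eq_bot]
  have hc' : Ideal.span {c} ≠ ⊥ := by rwa [Ne, Ideal.span_singleton_eq_bot]
  have hbcK : (b : K) / c ≠ 0 := div_ne_zero (by exact_mod_cast hb) (by exact_mod_cast hc)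
  rw [idealPow_mul_fun' ψ₁ ψ₂ hb', idealPow_mul_fun' ψ₁ ψ₂ hc', h₁.idealPow_span_eq b c hb hc hcop hbc hpos,
    h₂.idealPow_span_eq b c hb hc hcop hbc hpos, mul_mul_mul_comm, ← Finset.prod_mul_distrib]
  refine congrArg _ (Finset.prod_congr rfl fun w _ => ?_)
  have hw : w.embedding ((b : K) / c) ≠ 0 := (map_ne_zero _).2 hbcK
  have hw' : conj (w.embedding ((b : K) / c)) ≠ 0 := (map_ne_zero _).2 hw
  rw [zpow_add₀ hw, zpow_add₀ hw']
  ring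

/-! ### The absolute norm -/

/-- **`idealPow (v ↦ N v) 𝔞 = N 𝔞`** for `𝔞 ≠ 0` (unique factorisation and multiplicativity of
the absolute norm). [cite: NeukirchANT1999, Ch. III §1] -/
theorem idealPow_absNorm {I : Ideal (𝓞 K)} (hI : I ≠ ⊥) :
    LFunctions.idealPow K (fun v => ((Ideal.absNorm v.asIdeal : ℕ) : ℂ)) I = ((Ideal.absNorm I : ℕ) : ℂ) := by
  conv_rhs => rw [← Ideal.finprod_heightOneSpectrum_factorization hI]
  rw [map_finprod Ideal.absNorm (Ideal.hasFiniteMulSupport hI), Nat.cast_finprod']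
  unfold LFunctions.idealPow
  refine finprod_congr fun v => ?_
  rw [IsDedekindDomain.HeightOneSpectrum.maxPowDividing, map_pow, Nat.cast_pow]

/-- `N((b)) = ∏_w w(b) \overline{w(b)}` in a totally complex field. [folklore] -/
theorem absNorm_span_singleton_eq_prod [IsTotallyComplex K] (b : 𝓞 K) :
    ((Ideal.absNorm (Ideal.span {b}) : ℕ) : ℂ) =
      ∏ w : InfinitePlace K, w.embedding (b : K) * conj (w.embedding (b : K)) := by
  -- `N((b)) = |N_{K/ℚ}(b)| = ∏_w w(b)^2`
  have h1 : ((Ideal.absNorm (Ideal.span {b}) : ℕ) : ℝ) = |(Algebra.norm ℚ (b : K) : ℝ)| := by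
    rw [Ideal.absNorm_span_singleton, Nat.cast_natAbs, ← Algebra.coe_norm_int, Int.cast_abs]
    push_cast
    rfl
  have h2 : |(Algebra.norm ℚ (b : K) : ℝ)| = ∏ w : InfinitePlace K, (w (b : K)) ^ 2 := by
    rw [← Rat.cast_abs, ← InfinitePlace.prod_eq_abs_norm]
    refine Finset.prod_congr rfl fun w _ => ?_
    rw [InfinitePlace.mult, if_neg (InfinitePlace.not_isReal_iff_isComplex.2 (IsTotallyComplex.isComplex w))]
  have h3 : ((Ideal.absNorm (Ideal.span {b}) : ℕ) : ℂ) = (((Ideal.absNorm (Ideal.span {b}) : ℕ) : ℝ) : ℂ) := by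
    norm_cast
  rw [h3, h1, h2, Complex.ofReal_prod]
  refine Finset.prod_congr rfl fun w _ => ?_
  rw [Complex.mul_conj, Complex.normSq_eq_norm_sq, InfinitePlace.norm_embedding_eq, Complex.ofReal_pow]

/-- **The absolute norm is an algebraic Größencharakter of type `(1, 1)`** over a totally complex
field. [cite: NeukirchANT1999, Ch. VII §6] -/
theorem isGrossencharakter_absNorm [IsTotallyComplex K] (𝔣 : Ideal (𝓞 K)) :
    IsGrossencharakter 𝔣 (fun _ => 1) (fun _ => 1) (fun v => ((Ideal.absNorm v.asIdeal : ℕ) : ℂ)) := by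
  refine ⟨fun v _ => ?_, fun b c hb hc _ _ _ => ?_⟩
  · rw [Nat.cast_ne_zero, Ne, Ideal.absNorm_eq_zero_iff]
    exact v.ne_bot
  · have hb' : Ideal.span {b} ≠ ⊥ := by rwa [Ne, Ideal.span_singleton_eq_bot]
    have hc' : Ideal.span {c} ≠ ⊥ := by rwa [Ne, Ideal.span_singleton_eq_bot]
    have hcK : (c : K) ≠ 0 := by exact_mod_cast hc
    rw [idealPow_absNorm hb', idealPow_absNorm hc', absNorm_span_singleton_eq_prod, absNorm_span_singleton_eq_prod,
      ← Finset.prod_mul_distrib]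
    refine Finset.prod_congr rfl fun w _ => ?_
    have hwc : w.embedding (c : K) ≠ 0 := (map_ne_zero _).2 hcK
    have hwc' : conj (w.embedding (c : K)) ≠ 0 := (map_ne_zero _).2 hwc
    rw [zpow_one, zpow_one, map_div₀, map_div₀]
    field_simp

/-! ### The absolute norm over an arbitrary number field -/

/-- `N((x)) = ∏_w w(x)^{mult w}` (the absolute norm of a principal ideal as the product of the
normalised archimedean absolute values). [cite: NeukirchANT1999, Ch. III §1] -/
theorem absNorm_span_singleton_eq_prod_pow (x : 𝓞 K) :
    ((Ideal.absNorm (Ideal.span {x}) : ℕ) : ℝ) = ∏ w : InfinitePlace K, w (x : K) ^ w.mult := by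
  have h1 : ((Ideal.absNorm (Ideal.span {x}) : ℕ) : ℝ) = |(Algebra.norm ℚ (x : K) : ℝ)| := by
    rw [Ideal.absNorm_span_singleton, Nat.cast_natAbs, ← Algebra.coe_norm_int, Int.cast_abs]
    push_cast
    rfl
  rw [h1, ← Rat.cast_abs, ← InfinitePlace.prod_eq_abs_norm]

omit [NumberField K] in
/-- At an infinite place `w`, for `y` positive at every real embedding:
`w(y) · \overline{w(y)}^{mult w − 1} = |y|_w^{mult w}` in `ℂ` (at a real place `w(y) = |y|_w > 0`,
at a complex place `w(y) \overline{w(y)} = |y|_w²`). [folklore] -/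
theorem embedding_mul_conj_pow_eq (w : InfinitePlace K) {y : K} (hy : ∀ φ : K →+* ℝ, 0 < φ y) :
    w.embedding y * conj (w.embedding y) ^ (w.mult - 1) = ((w y : ℝ) : ℂ) ^ w.mult := by
  by_cases hw : w.IsReal
  · rw [InfinitePlace.mult, if_pos hw, Nat.sub_self, pow_zero, mul_one, pow_one,
      ← InfinitePlace.norm_embedding_eq, ← InfinitePlace.embedding_of_isReal_apply hw,
      Complex.norm_real, Real.norm_eq_abs, abs_of_pos (hy _)]
  · rw [InfinitePlace.mult, if_neg hw, show 2 - 1 = 1 from rfl, pow_one, Complex.mul_conj,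
      Complex.normSq_eq_norm_sq, InfinitePlace.norm_embedding_eq, Complex.ofReal_pow]

/-- **The absolute norm is an algebraic Größencharakter of type `(1, mult − 1)`** over ANY number
field (modulo any `𝔣`): for `b ≡ c` with `b/c` totally positive,
`N((b)) = N((c)) · ∏_w w(b/c) · \overline{w(b/c)}^{mult w − 1}` — type `(1, 0)` at the real places,
`(1, 1)` at the complex ones (`isGrossencharakter_absNorm` is the totally complex case).
[cite: NeukirchANT1999, Ch. VII §6] -/
theorem isGrossencharakter_absNorm' (𝔣 : Ideal (𝓞 K)) :
    IsGrossencharakter 𝔣 (fun _ => 1) (fun w => ((w.mult - 1 : ℕ) : ℤ))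
      (fun v => ((Ideal.absNorm v.asIdeal : ℕ) : ℂ)) := by
  refine ⟨fun v _ => ?_, fun b c hb hc _ _ hpos => ?_⟩
  · rw [Nat.cast_ne_zero, Ne, Ideal.absNorm_eq_zero_iff]
    exact v.ne_bot
  · have hb' : Ideal.span {b} ≠ ⊥ := by rwa [Ne, Ideal.span_singleton_eq_bot]
    have hc' : Ideal.span {c} ≠ ⊥ := by rwa [Ne, Ideal.span_singleton_eq_bot]
    have hcK : (c : K) ≠ 0 := by exact_mod_cast hc
    have hy : ∀ φ : K →+* ℝ, 0 < φ ((b : K) / c) := fun φ => by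
      rw [map_div₀]
      exact div_pos_iff.2 (mul_pos_iff.1 (hpos φ))
    have h3 : ∀ x : 𝓞 K, ((Ideal.absNorm (Ideal.span {x}) : ℕ) : ℂ) =
        (((Ideal.absNorm (Ideal.span {x}) : ℕ) : ℝ) : ℂ) := fun x => by norm_cast
    rw [idealPow_absNorm hb', idealPow_absNorm hc', h3 b, h3 c, absNorm_span_singleton_eq_prod_pow,
      absNorm_span_singleton_eq_prod_pow, Complex.ofReal_prod, Complex.ofReal_prod,
      ← Finset.prod_mul_distrib]
    refine Finset.prod_congr rfl fun w _ => ?_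
    have hwc : ((w (c : K) : ℝ) : ℂ) ≠ 0 := by
      rw [Complex.ofReal_ne_zero]
      exact (InfinitePlace.pos_iff.2 hcK).ne'
    rw [zpow_one, zpow_natCast, embedding_mul_conj_pow_eq w hy, Complex.ofReal_pow, Complex.ofReal_pow,
      map_div₀, Complex.ofReal_div, div_pow, mul_div_cancel₀ _ (pow_ne_zero _ hwc)]

end Literature.NumberTheory.GaloisRepresentations
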